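import Mathlib.Analysis.SpecialFunctions.Pow.Real
import HarnessLib

/-!
# PCINT lane, reduction B3c (`chordchain_cw`, bond chain bookkeeping): the per-site probability inequality

Cell `prim-pcint` (PAPER-2 track (iii): certified intervals for `p_c(ℤ^d)`), seat `prim-pcint-2` (gen 4); support file
(`--supports stmt-CriticalPhenomena-4575`).  Does NOT build on p205010.  Memo: `run/shared/lean/prim/pcint/REDUCTIONS.md` §B3c
(bond refinement: B3r with the chain bonus of B2c) — this file replaces the per-chain case analysis of §B3c.1 by ONE inequality.

At an off-path site `w` with `r` incidence edges (independent, each open with probability `p`), a lex-least open geodesic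
forbids every BAD pair of incidence edges to be open together; the bad-pair graph contains all non-consecutive pairs, so the
open incidence edges form a set of size `≤ 1` or a GOOD consecutive pair, whence
`P(F_w) ≤ (1-p)^r + r p (1-p)^{r-1} + g p² (1-p)^{r-2} =: siteProb r g p` (`g` = number of good pairs).  The B3c rule pays
`U` units `s = (1-p²)^{1/2}` at `w`, with (`…ChainBondReduction`): `U ≤ r` and `g ≤ r - 2` when the first pair is bad,
`U ≤ r - 2` and `g ≤ r - 1` when it is good.  PROVED here (pure real inequalities, `0 ≤ p ≤ 1/2`, `0 ≤ s ≤ 1`, `s² ≥ 1 - p²`):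
`siteProb_le_pow_of_first_bad : g + 2 ≤ r → U ≤ r → siteProb r g p ≤ s ^ U` and
`siteProb_le_pow_of_first_good : g + 1 ≤ r → U + 2 ≤ r → siteProb r g p ≤ s ^ U`.
The binding case is `r = 3`, `g = 1`, `U = 3`: `(1-p)(1+p-p²) ≤ s³`, which needs `p² ≤ 1/2`.
-/

noncomputable section

namespace Summit.CriticalPhenomena.PercolationContinuityZ3.Theorems.Pcint

namespace ChainBond

/-- The site probability bound `(1-p)^r + r p (1-p)^{r-1} + g p² (1-p)^{r-2}`: at most one of `r` independent edges open,
or exactly one of `g` designated pairs open. [folklore] -/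
def siteProb (r g : ℕ) (p : ℝ) : ℝ :=
  (1 - p) ^ r + r * p * (1 - p) ^ (r - 1) + g * p ^ 2 * (1 - p) ^ (r - 2)

/-- `siteProb` is monotone in the number of good pairs. [folklore] -/
theorem siteProb_mono {r g g' : ℕ} {p : ℝ} (hp1 : p ≤ 1) (hg : g ≤ g') :
    siteProb r g p ≤ siteProb r g' p := by
  unfold siteProb
  have : (g : ℝ) ≤ g' := by exact_mod_cast hg
  have h0 : 0 ≤ (1 - p) ^ (r - 2) := pow_nonneg (by linarith) _
  have h1 : 0 ≤ p ^ 2 * (1 - p) ^ (r - 2) := mul_nonneg (sq_nonneg p) h0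
  nlinarith

/-- Factored form for `r = m + 2`: `siteProb (m+2) g p = (1-p)^m ((1-p)² + (m+2) p (1-p) + g p²)`. [folklore] -/
theorem siteProb_add_two (m g : ℕ) (p : ℝ) :
    siteProb (m + 2) g p = (1 - p) ^ m * ((1 - p) ^ 2 + (m + 2 : ℝ) * p * (1 - p) + g * p ^ 2) := by
  unfold siteProb
  rw [show m + 2 - 1 = m + 1 by omega, show m + 2 - 2 = m by omega, pow_add, pow_succ]
  push_cast
  ring

/-- With `g = m` good pairs: `siteProb (m+2) m p = (1-p)^m (1 + m p - p²)`. [folklore] -/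
theorem siteProb_add_two_self (m : ℕ) (p : ℝ) : siteProb (m + 2) m p = (1 - p) ^ m * (1 + m * p - p ^ 2) := by
  rw [siteProb_add_two]; ring

/-- With `g = m + 1` good pairs: `siteProb (m+2) (m+1) p = (1-p)^m (1 + m p)`. [folklore] -/
theorem siteProb_add_two_succ (m : ℕ) (p : ℝ) : siteProb (m + 2) (m + 1) p = (1 - p) ^ m * (1 + m * p) := by
  rw [siteProb_add_two]; push_cast; ring

section Ineq

variable {p s : ℝ} (hp0 : 0 ≤ p) (hp : p ≤ 1 / 2) (hs0 : 0 ≤ s) (hs1 : s ≤ 1) (hps : 1 - p ^ 2 ≤ s ^ 2)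
include hp0 hp hs0 hs1 hps

omit hs0 hs1 in
/-- `1 - p ≤ s²`. [folklore] -/
theorem one_sub_le_sq : 1 - p ≤ s ^ 2 := by nlinarith

/-- `(1-p)^k ≤ s^k`. [folklore] -/
theorem one_sub_pow_le (k : ℕ) : (1 - p) ^ k ≤ s ^ k := by
  have h1 : 1 - p ≤ s := by nlinarith [one_sub_le_sq hp0 hp hps]
  exact pow_le_pow_left₀ (by linarith) h1 k

/-- `(1-p)^(k+1) ≤ s^(k+2)` (one factor `1-p ≤ s²`, the others `1-p ≤ s`). [folklore] -/
theorem one_sub_pow_succ_le (k : ℕ) : (1 - p) ^ (k + 1) ≤ s ^ (k + 2) := by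
  rw [pow_succ, pow_add]
  exact mul_le_mul (one_sub_pow_le hp0 hp hs0 hs1 hps k) (one_sub_le_sq hp0 hp hps) (by linarith)
    (pow_nonneg hs0 _)

omit hs1 in
/-- The case `r = 3`, first pair bad: `(1-p)(1+p-p²) ≤ s³` (needs `p² ≤ 1/2`). [folklore] -/
theorem core_three : (1 - p) * (1 + p - p ^ 2) ≤ s ^ 3 := by
  -- `1 + p - p² ≤ s (1+p)` by comparing squares, then multiply by `1 - p` and use `(1-p)(1+p) ≤ s²`
  have ha : 0 ≤ 1 + p - p ^ 2 := by nlinarith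
  have hb : 0 ≤ s * (1 + p) := by positivity
  have hsq : (1 + p - p ^ 2) ^ 2 ≤ (s * (1 + p)) ^ 2 := by
    have h1 : (1 + p - p ^ 2) ^ 2 ≤ (1 - p ^ 2) * (1 + p) ^ 2 := by
      have hdiff : (1 - p ^ 2) * (1 + p) ^ 2 - (1 + p - p ^ 2) ^ 2 = p ^ 2 * (1 - 2 * p ^ 2) := by ring
      have hnn : 0 ≤ p ^ 2 * (1 - 2 * p ^ 2) := mul_nonneg (sq_nonneg p) (by nlinarith)
      linarith
    have h2 : (1 - p ^ 2) * (1 + p) ^ 2 ≤ s ^ 2 * (1 + p) ^ 2 := mul_le_mul_of_nonneg_right hps (sq_nonneg _)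
    nlinarith
  have hle : 1 + p - p ^ 2 ≤ s * (1 + p) := (pow_le_pow_iff_left₀ ha hb two_ne_zero).1 hsq
  calc (1 - p) * (1 + p - p ^ 2) ≤ (1 - p) * (s * (1 + p)) := mul_le_mul_of_nonneg_left hle (by linarith)
    _ = s * ((1 - p) * (1 + p)) := by ring
    _ ≤ s * s ^ 2 := mul_le_mul_of_nonneg_left (by nlinarith) hs0
    _ = s ^ 3 := by ring

/-- **Core inequality, first pair bad**: `(1-p)^m (1 + m p - p²) ≤ s^(m+2)` for all `m`. [folklore] -/
theorem core_bad : ∀ m : ℕ, (1 - p) ^ m * (1 + m * p - p ^ 2) ≤ s ^ (m + 2)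
  | 0 => by rw [pow_zero, one_mul, Nat.cast_zero, zero_mul, add_zero, zero_add]; exact hps
  | 1 => by
    simpa only [pow_one, Nat.cast_one, one_mul] using core_three hp0 hp hs0 hps
  | m + 2 => by
    have ih := core_bad m
    have hq0 : 0 ≤ 1 - p := by linarith
    have hstep : (1 - p) ^ (m + 1) ≤ s ^ (m + 2) := one_sub_pow_succ_le hp0 hp hs0 hs1 hps m
    -- `(1-p)^{m+2}(1+(m+2)p-p²) = (1-p)²·[(1-p)^m (1+mp-p²)] + 2p (1-p)^{m+2}`
    have hexp : (1 - p) ^ (m + 2) * (1 + ((m + 2 : ℕ) : ℝ) * p - p ^ 2) =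
        (1 - p) ^ 2 * ((1 - p) ^ m * (1 + m * p - p ^ 2)) + 2 * p * (1 - p) * (1 - p) ^ (m + 1) := by
      push_cast; ring
    rw [hexp]
    calc (1 - p) ^ 2 * ((1 - p) ^ m * (1 + m * p - p ^ 2)) + 2 * p * (1 - p) * (1 - p) ^ (m + 1)
        ≤ (1 - p) ^ 2 * s ^ (m + 2) + 2 * p * (1 - p) * s ^ (m + 2) :=
          add_le_add (mul_le_mul_of_nonneg_left ih (sq_nonneg _))
            (mul_le_mul_of_nonneg_left hstep (by positivity))
      _ = ((1 - p) * (1 + p)) * s ^ (m + 2) := by ring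
      _ ≤ s ^ 2 * s ^ (m + 2) := mul_le_mul_of_nonneg_right (by nlinarith) (pow_nonneg hs0 _)
      _ = s ^ (m + 2 + 2) := by ring

/-- **Core inequality, first pair good**: `(1-p)^m (1 + m p) ≤ s^m`. [folklore] -/
theorem core_good (m : ℕ) : (1 - p) ^ m * (1 + m * p) ≤ s ^ m := by
  have hq0 : 0 ≤ 1 - p := by linarith
  have hb : 1 + (m : ℝ) * p ≤ (1 + p) ^ m := one_add_mul_le_pow (by linarith) m
  calc (1 - p) ^ m * (1 + m * p) ≤ (1 - p) ^ m * (1 + p) ^ m := mul_le_mul_of_nonneg_left hb (pow_nonneg hq0 _)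
    _ = ((1 - p) * (1 + p)) ^ m := by rw [mul_pow]
    _ ≤ (s ^ 2) ^ m := pow_le_pow_left₀ (by positivity) (by nlinarith) m
    _ = s ^ m * s ^ m := by rw [← pow_mul, two_mul, pow_add]
    _ ≤ s ^ m * 1 := mul_le_mul_of_nonneg_left (pow_le_one₀ hs0 hs1) (pow_nonneg hs0 _)
    _ = s ^ m := mul_one _

/-- **Per-site inequality when the first pair is bad** (`U ≤ r` units, `g ≤ r - 2` good pairs). [folklore] -/
theorem siteProb_le_pow_of_first_bad {r g U : ℕ} (hg : g + 2 ≤ r) (hU : U ≤ r) : siteProb r g p ≤ s ^ U := by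
  obtain ⟨m, rfl⟩ : ∃ m, r = m + 2 := ⟨r - 2, by omega⟩
  calc siteProb (m + 2) g p ≤ siteProb (m + 2) m p := siteProb_mono (by linarith) (by omega)
    _ = (1 - p) ^ m * (1 + m * p - p ^ 2) := siteProb_add_two_self m p
    _ ≤ s ^ (m + 2) := core_bad hp0 hp hs0 hs1 hps m
    _ ≤ s ^ U := pow_le_pow_of_le_one hs0 hs1 hU

/-- **Per-site inequality when the first pair is good** (`U + 2 ≤ r` units, `g + 1 ≤ r` good pairs). [folklore] -/
theorem siteProb_le_pow_of_first_good {r g U : ℕ} (hg : g + 1 ≤ r) (hU : U + 2 ≤ r) : siteProb r g p ≤ s ^ U := by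
  obtain ⟨m, rfl⟩ : ∃ m, r = m + 2 := ⟨r - 2, by omega⟩
  calc siteProb (m + 2) g p ≤ siteProb (m + 2) (m + 1) p := siteProb_mono (by linarith) (by omega)
    _ = (1 - p) ^ m * (1 + m * p) := siteProb_add_two_succ m p
    _ ≤ s ^ m := core_good hp0 hp hs0 hs1 hps m
    _ ≤ s ^ U := pow_le_pow_of_le_one hs0 hs1 (by omega)

end Ineq

/-- The trivial case of at most one incidence: `siteProb r 0 p ≤ 1` for `r ≤ 1` (no pair at all). [folklore] -/
theorem siteProb_le_one_of_le_one {r : ℕ} (hr : r ≤ 1) (p : ℝ) : siteProb r 0 p ≤ 1 := by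
  unfold siteProb
  rcases Nat.le_one_iff_eq_zero_or_eq_one.1 hr with rfl | rfl
  · simp
  · simp only [pow_one, Nat.cast_one, one_mul, Nat.sub_self, pow_zero, mul_one, Nat.cast_zero, zero_mul, add_zero]
    linarith

end ChainBond

end Summit.CriticalPhenomena.PercolationContinuityZ3.Theorems.Pcint
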